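import Summits.CriticalPhenomena.PercolationContinuityZ3.Theorems.PercNearOneGluingNoHeavyLowerTailAntitheticOneSidedCubes
import HarnessLib

/-!
# `NoHeavyLowerTail` (stmt-CriticalPhenomena-4575) — antithetic cluster pairs: CONDITIONAL LIFTS of a 𝒮×𝒮-positive family by a NESTED
# context and by a COMPLEMENT PAIR of contexts (the two part lemmas of …AntitheticSeriesComparable; prim-hp-2 gen 65, HOME/MEMO-gen65.md §1)

Support file (`--supports stmt-CriticalPhenomena-4575`, hull-port prover `prim-hp-2`, gen 65).  No definitions, no named facts, no sorries;
standard axioms.  Purely abstract (finite sums).  𝒮 = twisted-monotone (`K` grows when the first argument grows and the second shrinks)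
super-odd (`K P Q + K Q P ≥ 0`) test functions `K : Set V → Set V → ℝ`; a finite family `(A j, B j)_{j ∈ F}` is 𝒮×𝒮-POSITIVE if
`Σ_{j ∈ F} K₁K₂(A j, B j) ≥ 0` for all `K₁, K₂ ∈ 𝒮`.  The CONDITIONAL LIFT by a context `(X₁, Y₁)` through the cut vertex `c` is
`(A', B') ↦ (X₁ ∪ {u | c ∈ X₁ ∧ u ∈ A'}, Y₁ ∪ {u | c ∈ Y₁ ∧ u ∈ B'})` (the clusters of a series composition, `Antithetic.OneSum.cluster_eq`).
* `Antithetic.Series.nested_lift_sum_nonneg` — NESTED context `Y₁ ⊆ X₁`: the lift of a test function in 𝒮 is in 𝒮 (super-oddness uses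
  `Y₁ ⊆ X₁` once), so the lifted family is 𝒮×𝒮-positive.
* `Antithetic.Series.pair_lift_sum_nonneg` — COMPLEMENT PAIR `(X₁, Y₁), (Y₁, X₁)` with `X₁ ⊆ Y₁`: the sum of the two lifted families is
  nonnegative — Chebyshev on the increasing pair `(X₁∪[c]A, Y₁∪[c]B) ≼ (Y₁∪[c]A, X₁∪[c]B)` and the pair-summed test functions are EXACTLY
  antipodal, hence super-odd (a red-dominated 1-cube of lift maps, cf. `Antithetic.lift_composition_sum_nonneg`).
[cite: VandenbergHaggstromKahn2005, §1 p. 6 ("Harris' inequality")]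
-/

noncomputable section

namespace Summit.CriticalPhenomena.PercolationContinuityZ3.Theorems

open scoped Classical

namespace Antithetic

namespace Series

variable {V : Type*}

section Lifts

variable {J : Type*} (F : Finset J) (A B : J → Set V) (c : V)
  (hplus : ∀ K₁ K₂ : Set V → Set V → ℝ,
    (∀ ⦃P P' Q Q' : Set V⦄, P ⊆ P' → Q' ⊆ Q → K₁ P Q ≤ K₁ P' Q') → (∀ P Q, 0 ≤ K₁ P Q + K₁ Q P) →
    (∀ ⦃P P' Q Q' : Set V⦄, P ⊆ P' → Q' ⊆ Q → K₂ P Q ≤ K₂ P' Q') → (∀ P Q, 0 ≤ K₂ P Q + K₂ Q P) →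
    0 ≤ ∑ j ∈ F, K₁ (A j) (B j) * K₂ (A j) (B j))
  {K₁ K₂ : Set V → Set V → ℝ}
  (hK₁ : ∀ ⦃P P' Q Q' : Set V⦄, P ⊆ P' → Q' ⊆ Q → K₁ P Q ≤ K₁ P' Q') (hso₁ : ∀ P Q, 0 ≤ K₁ P Q + K₁ Q P)
  (hK₂ : ∀ ⦃P P' Q Q' : Set V⦄, P ⊆ P' → Q' ⊆ Q → K₂ P Q ≤ K₂ P' Q') (hso₂ : ∀ P Q, 0 ≤ K₂ P Q + K₂ Q P)
include hplus hK₁ hso₁ hK₂ hso₂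

/-- **Nested context.**  If `Y₁ ⊆ X₁` then the conditional lift `(A', B') ↦ K(X₁ ∪ [c ∈ X₁]A', Y₁ ∪ [c ∈ Y₁]B')` of a test function in 𝒮 is
in 𝒮, so a 𝒮×𝒮-positive far family stays positive after the lift. [this work] -/
theorem nested_lift_sum_nonneg (X₁ Y₁ : Set V) (hYX : Y₁ ⊆ X₁) :
    0 ≤ ∑ j ∈ F, K₁ (X₁ ∪ {u | c ∈ X₁ ∧ u ∈ A j}) (Y₁ ∪ {u | c ∈ Y₁ ∧ u ∈ B j}) *
      K₂ (X₁ ∪ {u | c ∈ X₁ ∧ u ∈ A j}) (Y₁ ∪ {u | c ∈ Y₁ ∧ u ∈ B j}) := by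
  let L : Set V → Set V → Set V := fun P S => P ∪ {u | c ∈ P ∧ u ∈ S}
  have hLr : ∀ P : Set V, Monotone (L P) := by
    intro P S S' h u hu
    rcases hu with hu | ⟨hc, hu⟩
    · exact Or.inl hu
    · exact Or.inr ⟨hc, h hu⟩
  have hLl : ∀ (S : Set V) ⦃P P' : Set V⦄, P ⊆ P' → L P S ⊆ L P' S := by
    intro S P P' h u hu
    rcases hu with hu | ⟨hc, hu⟩
    · exact Or.inl (h hu)
    · exact Or.inr ⟨h hc, hu⟩
  have hmono : ∀ {K : Set V → Set V → ℝ}, (∀ ⦃P P' Q Q' : Set V⦄, P ⊆ P' → Q' ⊆ Q → K P Q ≤ K P' Q') →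
      ∀ ⦃P P' Q Q' : Set V⦄, P ⊆ P' → Q' ⊆ Q → K (L X₁ P) (L Y₁ Q) ≤ K (L X₁ P') (L Y₁ Q') :=
    fun hK P P' Q Q' hP hQ => hK (hLr X₁ hP) (hLr Y₁ hQ)
  have hso : ∀ {K : Set V → Set V → ℝ}, (∀ ⦃P P' Q Q' : Set V⦄, P ⊆ P' → Q' ⊆ Q → K P Q ≤ K P' Q') →
      (∀ P Q, 0 ≤ K P Q + K Q P) → ∀ P Q, 0 ≤ K (L X₁ P) (L Y₁ Q) + K (L X₁ Q) (L Y₁ P) := by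
    intro K hK hsoK P Q
    have h1 : K (L Y₁ Q) (L X₁ P) ≤ K (L X₁ Q) (L Y₁ P) := hK (hLl Q hYX) (hLl P hYX)
    have h2 := hsoK (L X₁ P) (L Y₁ Q)
    linarith
  exact hplus (fun P Q => K₁ (L X₁ P) (L Y₁ Q)) (fun P Q => K₂ (L X₁ P) (L Y₁ Q)) (hmono hK₁) (hso hK₁ hso₁) (hmono hK₂)
    (hso hK₂ hso₂)

/-- **Complement pair of contexts.**  If `X₁ ⊆ Y₁` then the sum of the two conditional lifts by `(X₁, Y₁)` and by `(Y₁, X₁)` of a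
𝒮×𝒮-positive far family is nonnegative: Chebyshev on the increasing pair `(X₁∪[c]A, Y₁∪[c]B) ≼ (Y₁∪[c]A, X₁∪[c]B)`, and the pair-summed
test functions are exactly antipodal, hence super-odd. [this work] -/
theorem pair_lift_sum_nonneg (X₁ Y₁ : Set V) (hXY : X₁ ⊆ Y₁) :
    0 ≤ ∑ j ∈ F, (K₁ (X₁ ∪ {u | c ∈ X₁ ∧ u ∈ A j}) (Y₁ ∪ {u | c ∈ Y₁ ∧ u ∈ B j}) *
        K₂ (X₁ ∪ {u | c ∈ X₁ ∧ u ∈ A j}) (Y₁ ∪ {u | c ∈ Y₁ ∧ u ∈ B j}) +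
      K₁ (Y₁ ∪ {u | c ∈ Y₁ ∧ u ∈ A j}) (X₁ ∪ {u | c ∈ X₁ ∧ u ∈ B j}) *
        K₂ (Y₁ ∪ {u | c ∈ Y₁ ∧ u ∈ A j}) (X₁ ∪ {u | c ∈ X₁ ∧ u ∈ B j})) := by
  let L : Set V → Set V → Set V := fun P S => P ∪ {u | c ∈ P ∧ u ∈ S}
  have hLr : ∀ P : Set V, Monotone (L P) := by
    intro P S S' h u hu
    rcases hu with hu | ⟨hc, hu⟩
    · exact Or.inl hu
    · exact Or.inr ⟨hc, h hu⟩
  have hLl : ∀ (S : Set V) ⦃P P' : Set V⦄, P ⊆ P' → L P S ⊆ L P' S := by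
    intro S P P' h u hu
    rcases hu with hu | ⟨hc, hu⟩
    · exact Or.inl (h hu)
    · exact Or.inr ⟨h hc, hu⟩
  -- the pair-summed test functions
  let G₁ : Set V → Set V → ℝ := fun P Q => K₁ (L X₁ P) (L Y₁ Q) + K₁ (L Y₁ P) (L X₁ Q)
  let G₂ : Set V → Set V → ℝ := fun P Q => K₂ (L X₁ P) (L Y₁ Q) + K₂ (L Y₁ P) (L X₁ Q)
  have hmono : ∀ {K : Set V → Set V → ℝ}, (∀ ⦃P P' Q Q' : Set V⦄, P ⊆ P' → Q' ⊆ Q → K P Q ≤ K P' Q') →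
      ∀ ⦃P P' Q Q' : Set V⦄, P ⊆ P' → Q' ⊆ Q →
        K (L X₁ P) (L Y₁ Q) + K (L Y₁ P) (L X₁ Q) ≤ K (L X₁ P') (L Y₁ Q') + K (L Y₁ P') (L X₁ Q') :=
    fun hK P P' Q Q' hP hQ => add_le_add (hK (hLr X₁ hP) (hLr Y₁ hQ)) (hK (hLr Y₁ hP) (hLr X₁ hQ))
  have hso : ∀ {K : Set V → Set V → ℝ}, (∀ P Q, 0 ≤ K P Q + K Q P) →
      ∀ P Q, 0 ≤ (K (L X₁ P) (L Y₁ Q) + K (L Y₁ P) (L X₁ Q)) + (K (L X₁ Q) (L Y₁ P) + K (L Y₁ Q) (L X₁ P)) := by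
    intro K hsoK P Q
    have h1 := hsoK (L X₁ P) (L Y₁ Q)
    have h2 := hsoK (L Y₁ P) (L X₁ Q)
    linarith
  have hpos : 0 ≤ ∑ j ∈ F, G₁ (A j) (B j) * G₂ (A j) (B j) :=
    hplus G₁ G₂ (hmono hK₁) (hso hso₁) (hmono hK₂) (hso hso₂)
  -- Chebyshev termwise: `2 (ab + a'b') ≥ (a + a')(b + b')` when `a ≤ a'`, `b ≤ b'`
  have hterm : ∀ j ∈ F, G₁ (A j) (B j) * G₂ (A j) (B j) ≤
      2 * (K₁ (L X₁ (A j)) (L Y₁ (B j)) * K₂ (L X₁ (A j)) (L Y₁ (B j)) +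
        K₁ (L Y₁ (A j)) (L X₁ (B j)) * K₂ (L Y₁ (A j)) (L X₁ (B j))) := by
    intro j _
    have ha : K₁ (L X₁ (A j)) (L Y₁ (B j)) ≤ K₁ (L Y₁ (A j)) (L X₁ (B j)) := hK₁ (hLl (A j) hXY) (hLl (B j) hXY)
    have hb : K₂ (L X₁ (A j)) (L Y₁ (B j)) ≤ K₂ (L Y₁ (A j)) (L X₁ (B j)) := hK₂ (hLl (A j) hXY) (hLl (B j) hXY)
    have hab := mul_nonneg (sub_nonneg.2 ha) (sub_nonneg.2 hb)
    show (K₁ (L X₁ (A j)) (L Y₁ (B j)) + K₁ (L Y₁ (A j)) (L X₁ (B j))) *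
        (K₂ (L X₁ (A j)) (L Y₁ (B j)) + K₂ (L Y₁ (A j)) (L X₁ (B j))) ≤ _
    nlinarith [hab]
  have hle := Finset.sum_le_sum hterm
  rw [← Finset.mul_sum] at hle
  have h2 : (0 : ℝ) < 2 := by norm_num
  exact (mul_nonneg_iff_of_pos_left h2).1 (le_trans hpos hle)

end Lifts

end Series

end Antithetic

end Summit.CriticalPhenomena.PercolationContinuityZ3.Theorems
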